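import Literature.Probability.LatticeModels.PlaneRotatorNatCurrents
import Literature.Probability.LatticeModels.RivasseauDigraphLemma
import Literature.Probability.LatticeModels.PlaneRotatorLiebRivasseauInequality
import Mathlib.Analysis.Normed.Ring.InfiniteSum
import HarnessLib

/-!
# The Lieb–Rivasseau separating inequality for plane rotators is a theorem

Topic `Literature/Probability/LatticeModels`. This file DISCHARGES the tree's named fact
`PlaneRotator.LiebRivasseauInequality` (`PlaneRotatorLiebRivasseauInequality.lean`): E. H. Lieb, *A refinement of
Simon's correlation inequality*, Comm. Math. Phys. 77 (1980) 127–135 [Lieb1980], eq. (23), for ALL inside systems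
(V. Rivasseau, *Lieb's correlation inequality for plane rotors*, Comm. Math. Phys. 77 (1980) 145–147
[Rivasseau1980]): for finite `V`, `A, C ⊆ V`, non-negative pair couplings `J_A` supported on `A × A` and `J_C` on
`C × C`, `a ∈ A`, `c ∈ C`,

  `⟨cos(θ_a − θ_c)⟩_{J_A+J_C} ≤ ∑_{b ∈ A ∩ C} ⟨cos(θ_a − θ_b)⟩_{J_A} ⟨cos(θ_b − θ_c)⟩_{J_A+J_C}`.

* `PlaneRotator.liebRivasseauInequality_holds : LiebRivasseauInequality` — **the theorem**. Consequently the
  tree's conditional results become unconditional by application: Lieb's Theorem-4-type decay criteria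
  (`twoPoint_le_sum_star`, `twoPoint_le_pow_of_star_rowSum_le`) and the layer decoupling of the layered XY model
  (`twoPoint_layered_le_pow_interlayer_of_liebRivasseau`, `LayeredPlaneRotatorDecoupling.lean`).

Proof (Lieb's programme, p. 133, with Rivasseau's lemma): expand every unnormalised character integral in
non-negative integer Poisson currents (`PlaneRotatorPoissonCurrents.lean`, `PlaneRotatorNatCurrents.lean`); the
product of the expansions of `N_J(a,c) = ∫ cos(θ_a−θ_c) e^{H_A+H_C}` and `Z_A = ∫ e^{H_A}` (resp. of
`N_A(a,b)` and `N_J(b,c)`) is regrouped by the TOTAL current `T = n₁ + n₂` (`tsum_pair_eq_tsum_sum_subMult`); the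
two currents of total `T` are the `∏ C(T_α, j_α)` sub-multisets `j ≤ T` of `T` distinguishable arrows, with
`W_J(T − j) W_A(j) = [supp j ⊆ A-slots] W_J(T) ∏ C(T_α, j_α)` (`term_identity`; disjoint slot supports) and the
valence constraints collapsing to ONE constraint on `T` (`balances_sub_iff`); termwise in `T` the inequality is
Rivasseau's digraph lemma in multiplicity form (`Rivasseau.sum_choose_mval_zero_le'`, `RivasseauDigraphLemma.lean`)
for the A-part of `T` with distinguished vertex `a` — its valence at `a` is `+1` and its negative-valence vertices lie
in `A ∩ C` (`inner_sum_le`). Reductions (`liebRivasseauInequality_holds`): the case `a ∈ C` is the term `b = a`;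
the `C × C` part of `J_A` is moved into `J_C` (Lieb, p. 133: "It is immaterial whether the B spins are connected
together, for any such interaction can be regarded as part of `H_C`"; Ginibre monotonicity `twoPoint_mono` restores
the stated right-hand side) and diagonal couplings are dropped (`twoPoint_congr_offDiag`), after which the slot
supports are disjoint; finally divide the unnormalised inequality (`liebRivasseau_unnormalised`) by `Z_J Z_A > 0`.

Cell use (`pub/hubbard-tc`, INTERLAYER-v0.1.md §14): key K4-c (layer decoupling) and the K5-Lieb column are now
kernel theorems about the classical XY model with NO named-fact hypothesis.
-/

noncomputable section

open MeasureTheory Filter Finset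
open scoped Topology BigOperators Nat

namespace Literature.Probability.LatticeModels

namespace PlaneRotator

variable {V : Type} [Fintype V] [DecidableEq V]

/-! ### P2. Regrouping a double series of `ℕ`-currents by the total current -/

section Regroup

variable {ι : Type*} [Fintype ι] [DecidableEq ι]

omit [Fintype ι] [DecidableEq ι] in
/-- The regrouping map `(n₁, n₂) ↦ (n₁ + n₂, n₂)` is injective. [folklore] -/
private theorem regroup_injective :
    Function.Injective fun p : (ι → ℕ) × (ι → ℕ) => (p.1 + p.2, p.2) := by
  rintro ⟨n₁, n₂⟩ ⟨m₁, m₂⟩ h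
  simp only [Prod.mk.injEq] at h
  obtain ⟨h1, h2⟩ := h
  subst h2
  simpa using h1

/-- **Regrouping by the total current.** For a summable double family `F(n₁, n₂)` of reals indexed by pairs of
`ℕ`-currents, `∑'_{(n₁,n₂)} F(n₁,n₂) = ∑'_T ∑_{j ≤ T} F(T − j, j)` (inner sum over the finite box
`Rivasseau.subMult T`). [cite: Lieb1980, p. 133 (subgraphs of the directed graph)] -/
theorem tsum_pair_eq_tsum_sum_subMult {F : (ι → ℕ) → (ι → ℕ) → ℝ}
    (hF : Summable fun p : (ι → ℕ) × (ι → ℕ) => F p.1 p.2) :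
    ∑' p : (ι → ℕ) × (ι → ℕ), F p.1 p.2 =
      ∑' T : ι → ℕ, ∑ j ∈ Rivasseau.subMult T, F (T - j) j := by
  classical
  -- `G (T, j) = [j ≤ T] F (T − j) j`, so that `G ∘ regroup = F`
  set G : (ι → ℕ) × (ι → ℕ) → ℝ := fun q => if ∀ a, q.2 a ≤ q.1 a then F (q.1 - q.2) q.2 else 0 with hG
  have hcomp : ∀ p : (ι → ℕ) × (ι → ℕ), G ((fun p : (ι → ℕ) × (ι → ℕ) => (p.1 + p.2, p.2)) p) = F p.1 p.2 := by
    rintro ⟨n₁, n₂⟩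
    simp only [hG]
    rw [if_pos (fun a => by simp), add_tsub_cancel_right]
  have hrange : ∀ q : (ι → ℕ) × (ι → ℕ), q ∉ Set.range (fun p : (ι → ℕ) × (ι → ℕ) => (p.1 + p.2, p.2)) → G q = 0 := by
    rintro ⟨T, j⟩ hq
    simp only [hG]
    rw [if_neg]
    intro hle
    exact hq ⟨(T - j, j), by simp only [Prod.mk.injEq, and_true]; exact tsub_add_cancel_of_le (fun a => hle a)⟩
  have hsupp : Function.support G ⊆ Set.range (fun p : (ι → ℕ) × (ι → ℕ) => (p.1 + p.2, p.2)) :=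
    fun q hq => by by_contra h; exact hq (hrange q h)
  have hGsum : Summable G := (regroup_injective.summable_iff hrange).1 (hF.congr fun p => (hcomp p).symm)
  calc ∑' p : (ι → ℕ) × (ι → ℕ), F p.1 p.2
      = ∑' p : (ι → ℕ) × (ι → ℕ), G ((fun p : (ι → ℕ) × (ι → ℕ) => (p.1 + p.2, p.2)) p) :=
        tsum_congr fun p => (hcomp p).symm
    _ = ∑' q, G q := regroup_injective.tsum_eq hsupp
    _ = ∑' T : ι → ℕ, ∑' j : ι → ℕ, G (T, j) := hGsum.tsum_prod
    _ = ∑' T : ι → ℕ, ∑ j ∈ Rivasseau.subMult T, F (T - j) j := by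
        refine tsum_congr fun T => ?_
        rw [tsum_eq_sum (s := Rivasseau.subMult T)]
        · refine Finset.sum_congr rfl fun j hj => ?_
          rw [Rivasseau.subMult, Fintype.mem_piFinset] at hj
          simp only [hG]
          rw [if_pos (fun a => Nat.lt_succ_iff.1 (Finset.mem_range.1 (hj a)))]
        · intro j hj
          simp only [hG]
          rw [if_neg]
          intro hle
          exact hj (by rw [Rivasseau.subMult, Fintype.mem_piFinset]; exact fun a => Finset.mem_range.2 (Nat.lt_succ_iff.2 (hle a)))

/-- Summability of the regrouped family `T ↦ ∑_{j ≤ T} F(T − j, j)`. [cite: Lieb1980, p. 133 (subgraphs of the directed graph)] -/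
theorem summable_sum_subMult {F : (ι → ℕ) → (ι → ℕ) → ℝ}
    (hF : Summable fun p : (ι → ℕ) × (ι → ℕ) => F p.1 p.2) :
    Summable fun T : ι → ℕ => ∑ j ∈ Rivasseau.subMult T, F (T - j) j := by
  classical
  set G : (ι → ℕ) × (ι → ℕ) → ℝ := fun q => if ∀ a, q.2 a ≤ q.1 a then F (q.1 - q.2) q.2 else 0 with hG
  have hcomp : ∀ p : (ι → ℕ) × (ι → ℕ), G ((fun p : (ι → ℕ) × (ι → ℕ) => (p.1 + p.2, p.2)) p) = F p.1 p.2 := by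
    rintro ⟨n₁, n₂⟩
    simp only [hG]
    rw [if_pos (fun a => by simp), add_tsub_cancel_right]
  have hrange : ∀ q : (ι → ℕ) × (ι → ℕ), q ∉ Set.range (fun p : (ι → ℕ) × (ι → ℕ) => (p.1 + p.2, p.2)) → G q = 0 := by
    rintro ⟨T, j⟩ hq
    simp only [hG]
    rw [if_neg]
    intro hle
    exact hq ⟨(T - j, j), by simp only [Prod.mk.injEq, and_true]; exact tsub_add_cancel_of_le (fun a => hle a)⟩
  have hGsum : Summable G := (regroup_injective.summable_iff hrange).1 (hF.congr fun p => (hcomp p).symm)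
  refine hGsum.prod.congr fun T => ?_
  rw [tsum_eq_sum (s := Rivasseau.subMult T)]
  · refine Finset.sum_congr rfl fun j hj => ?_
    rw [Rivasseau.subMult, Fintype.mem_piFinset] at hj
    simp only [hG]
    rw [if_pos (fun a => Nat.lt_succ_iff.1 (Finset.mem_range.1 (hj a)))]
  · intro j hj
    simp only [hG]
    rw [if_neg]
    intro hle
    exact hj (by rw [Rivasseau.subMult, Fintype.mem_piFinset]; exact fun a => Finset.mem_range.2 (Nat.lt_succ_iff.2 (hle a)))

end Regroup

/-! ### P3/P4. Weights and constraints under the regrouping -/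

omit [DecidableEq V] in
/-- A Poisson weight vanishes when the current charges a slot with zero coupling. [cite: Lieb1980, p. 133 (power series in β)] -/
theorem poissonWeight_eq_zero_of_charge {J : V × V → ℝ} {j : (V × V) × Bool → ℕ} {a : (V × V) × Bool}
    (hJ : J a.1 = 0) (hj : j a ≠ 0) : poissonWeight J j = 0 := by
  unfold poissonWeight
  refine Finset.prod_eq_zero (Finset.mem_univ a) ?_
  rw [hJ, zero_div, zero_pow hj, zero_div]

omit [DecidableEq V] in
/-- Poisson weights of a current agree for two couplings that agree on the charged slots. [cite: Lieb1980, p. 133 (power series in β)] -/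
theorem poissonWeight_congr {J J' : V × V → ℝ} {j : (V × V) × Bool → ℕ} (h : ∀ a, j a ≠ 0 → J a.1 = J' a.1) :
    poissonWeight J j = poissonWeight J' j := by
  unfold poissonWeight
  refine Finset.prod_congr rfl fun a _ => ?_
  by_cases hj : j a = 0
  · rw [hj, pow_zero, pow_zero]
  · rw [h a hj]

/-- The exponent of a difference of `ℕ`-currents (`j ≤ T`). [cite: Rivasseau1980, Lemma (p. 146)] -/
theorem exponent_natCast_sub {T j : (V × V) × Bool → ℕ} (hj : ∀ a, j a ≤ T a) (v : V) :
    exponent (fun a => ((T - j) a : ℤ)) v = exponent (fun a => (T a : ℤ)) v - exponent (fun a => (j a : ℤ)) v := by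
  unfold exponent
  rw [← Finset.sum_sub_distrib]
  refine Finset.sum_congr rfl fun a _ => ?_
  dsimp only
  rw [Pi.sub_apply, Nat.cast_sub (hj a)]
  ring

/-- Constraints under the regrouping: `(T − j)` balances `k` and `j` balances `k'` iff `T` balances `k + k'` and `j`
balances `k'`. [cite: Rivasseau1980, Lemma (p. 146)] -/
theorem balances_sub_iff {T j : (V × V) × Bool → ℕ} (hj : ∀ a, j a ≤ T a) (k k' : V → ℤ) :
    (Balances k (T - j) ∧ Balances k' j) ↔ (Balances (k + k') T ∧ Balances k' j) := by
  unfold Balances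
  constructor
  · rintro ⟨h1, h2⟩
    refine ⟨fun v => ?_, h2⟩
    have e1 := h1 v; have e2 := h2 v
    rw [exponent_natCast_sub hj] at e1
    simp only [Pi.add_apply]
    linarith
  · rintro ⟨h1, h2⟩
    refine ⟨fun v => ?_, h2⟩
    have e1 := h1 v; have e2 := h2 v
    rw [exponent_natCast_sub hj]
    simp only [Pi.add_apply] at e1
    linarith

/-! ### P5. The inner sums: Rivasseau's lemma on the A-slots -/

/-- The observable exponents `δ_y − δ_x` of `cos(θ_x − θ_y)` (`diffChar x y = monomialChar (kvec x y)`). [cite: Lieb1980, eq. (23)] -/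
def kvec (x y : V) : V → ℤ := (Pi.single y (1 : ℤ) : V → ℤ) - Pi.single x 1

omit [Fintype V] in
/-- `kvec x y v = [v = y] − [v = x]`. [folklore] -/
private theorem kvec_apply (x y v : V) : kvec x y v = (if v = y then 1 else 0) - (if v = x then 1 else 0) := by
  simp [kvec, Pi.single_apply]

/-- `Balances 0 j ↔ mval j ≡ 0` (bridge to Rivasseau's valence). [cite: Rivasseau1980, Lemma (p. 146)] -/
private theorem balances_zero_iff (j : (V × V) × Bool → ℕ) :
    Balances 0 j ↔ ∀ v, Rivasseau.mval arrowHead arrowTail j v = 0 := by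
  simp only [Balances, Pi.zero_apply, zero_add, exponent_natCast_eq_mval]

/-- `Balances (kvec a b) j ↔ mval j = δ_a − δ_b` (`a ≠ b`): valence `+1` at `a`, `−1` at `b`, `0` elsewhere.
[cite: Rivasseau1980, Lemma (p. 146)] -/
private theorem balances_kvec_iff {a b : V} (hab : a ≠ b) (j : (V × V) × Bool → ℕ) :
    Balances (kvec a b) j ↔ (Rivasseau.mval arrowHead arrowTail j a = 1 ∧ Rivasseau.mval arrowHead arrowTail j b = -1 ∧
      ∀ u, u ≠ a → u ≠ b → Rivasseau.mval arrowHead arrowTail j u = 0) := by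
  simp only [Balances, exponent_natCast_eq_mval, kvec_apply]
  constructor
  · intro h
    refine ⟨?_, ?_, fun u hua hub => ?_⟩
    · have := h a; rw [if_neg hab, if_pos rfl] at this; linarith
    · have := h b; rw [if_pos rfl, if_neg (Ne.symm hab)] at this; linarith
    · have := h u; rw [if_neg hub, if_neg hua] at this; linarith
  · rintro ⟨ha, hb, hu⟩ v
    by_cases hva : v = a
    · subst hva; rw [if_neg hab, if_pos rfl, ha]; ring
    by_cases hvb : v = b
    · subst hvb; rw [if_pos rfl, if_neg hva, hb]; ring
    · rw [if_neg hvb, if_neg hva, hu v hva hvb]; ring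

omit [Fintype V] [DecidableEq V] in
/-- An off-diagonal slot has distinct head and tail. [folklore] -/
private theorem arrowHead_ne_arrowTail {α : (V × V) × Bool} (h : α.1.1 ≠ α.1.2) : arrowHead α ≠ arrowTail α := by
  obtain ⟨⟨x, y⟩, b⟩ := α
  cases b <;> simp [arrowHead, arrowTail] <;> [exact h; exact fun e => h e.symm]

omit [Fintype V] [DecidableEq V] in
/-- The head of a slot is an endpoint of its pair. [folklore] -/
private theorem arrowHead_mem {α : (V × V) × Bool} {S : Finset V} (h : α.1.1 ∈ S ∧ α.1.2 ∈ S) : arrowHead α ∈ S := by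
  unfold arrowHead; split_ifs; exacts [h.2, h.1]

omit [Fintype V] [DecidableEq V] in
/-- The tail of a slot is an endpoint of its pair. [folklore] -/
private theorem arrowTail_mem {α : (V × V) × Bool} {S : Finset V} (h : α.1.1 ∈ S ∧ α.1.2 ∈ S) : arrowTail α ∈ S := by
  unfold arrowTail; split_ifs; exacts [h.1, h.2]

/-- The valence at `v` of a current supported on slots whose endpoints avoid `v` vanishes. [cite: Rivasseau1980, Lemma (p. 146)] -/
private theorem mval_eq_zero_of_avoids {T : (V × V) × Bool → ℕ} {v : V}
    (h : ∀ α, T α ≠ 0 → arrowHead α ≠ v ∧ arrowTail α ≠ v) : Rivasseau.mval arrowHead arrowTail T v = 0 := by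
  unfold Rivasseau.mval
  rw [Finset.sum_filter, Finset.sum_filter, ← Finset.sum_sub_distrib]
  refine Finset.sum_eq_zero fun α _ => ?_
  by_cases hT : T α = 0
  · simp [hT]
  · rw [if_neg (h α hT).1, if_neg (h α hT).2, sub_zero]

/-- Valence is additive in the current. [cite: Rivasseau1980, Lemma (p. 146)] -/
private theorem mval_add (T T' : (V × V) × Bool → ℕ) (v : V) :
    Rivasseau.mval arrowHead arrowTail (T + T') v =
      Rivasseau.mval arrowHead arrowTail T v + Rivasseau.mval arrowHead arrowTail T' v := by
  unfold Rivasseau.mval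
  simp only [Pi.add_apply, Nat.cast_add, Finset.sum_add_distrib]
  ring

/-- **The inner-sum inequality (P5).** Fix `T` in the support of the `J_A + J_C` expansion and balancing `δ_c − δ_a`
(`a ∉ C`, `c ∈ C`, `J_A` without diagonal couplings, slot supports of `J_A`, `J_C` in `A × A`, `C × C`). Then
`∑_{j ≤ T, supp j ⊆ S_A, mval j ≡ 0} ∏C(T,j) ≤ ∑_{b ∈ A∩C} ∑_{j ≤ T, supp j ⊆ S_A, mval j = δ_a − δ_b} ∏C(T,j)` —
Rivasseau's lemma for the A-part `T'` of `T` with distinguished vertex `a`. [cite: Rivasseau1980, Lemma (p. 146)] -/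
theorem inner_sum_le (A C : Finset V) (JA JC : V × V → ℝ) (hAsupp : ∀ p, JA p ≠ 0 → p.1 ∈ A ∧ p.2 ∈ A)
    (hCsupp : ∀ p, JC p ≠ 0 → p.1 ∈ C ∧ p.2 ∈ C) (hdiag : ∀ x, JA (x, x) = 0) {a c : V} (haC : a ∉ C) (hc : c ∈ C)
    {T : (V × V) × Bool → ℕ} (hT : ∀ α, T α ≠ 0 → JA α.1 ≠ 0 ∨ JC α.1 ≠ 0) (hBal : Balances (kvec a c) T) :
    ∑ j ∈ Rivasseau.subMult T,
        (if (∀ α, JA α.1 = 0 → j α = 0) ∧ Balances 0 j then ∏ α, ((T α).choose (j α) : ℝ) else 0) ≤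
      ∑ b ∈ A ∩ C, ∑ j ∈ Rivasseau.subMult T,
        (if (∀ α, JA α.1 = 0 → j α = 0) ∧ Balances (kvec a b) j then ∏ α, ((T α).choose (j α) : ℝ) else 0) := by
  classical
  have hac : a ≠ c := fun h => haC (h ▸ hc)
  -- the A-part `T'` and the C-part `T''` of `T`
  set T' : (V × V) × Bool → ℕ := fun α => if JA α.1 = 0 then 0 else T α with hT'
  set T'' : (V × V) × Bool → ℕ := fun α => if JA α.1 = 0 then T α else 0 with hT''
  have hsplit : T = T' + T'' := by
    funext α; simp only [hT', hT'', Pi.add_apply]; split_ifs <;> simp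
  -- valences of `T`: `+1` at `a`, `0` off `C ∪ {c}`... from the constraint
  have hmvalT : ∀ v, Rivasseau.mval arrowHead arrowTail T v = (if v = a then 1 else 0) - (if v = c then 1 else 0) := by
    intro v
    have h := hBal v
    rw [exponent_natCast_eq_mval, kvec_apply] at h
    linarith
  -- the C-part does not touch vertices outside `C`
  have hT''avoid : ∀ v, v ∉ C → Rivasseau.mval arrowHead arrowTail T'' v = 0 := by
    intro v hv
    refine mval_eq_zero_of_avoids fun α hα => ?_
    have hJA : JA α.1 = 0 := by
      by_contra h; simp only [hT'', if_neg h] at hα; exact hα rfl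
    have hTα : T α ≠ 0 := by simp only [hT'', if_pos hJA] at hα; exact hα
    have hJC : JC α.1 ≠ 0 := (hT α hTα).resolve_left (not_not.2 hJA)
    have hmem := hCsupp α.1 hJC
    exact ⟨fun h => hv (h ▸ arrowHead_mem hmem), fun h => hv (h ▸ arrowTail_mem hmem)⟩
  -- the A-part only touches vertices of `A`
  have hT'avoid : ∀ v, v ∉ A → Rivasseau.mval arrowHead arrowTail T' v = 0 := by
    intro v hv
    refine mval_eq_zero_of_avoids fun α hα => ?_
    have hJA : JA α.1 ≠ 0 := by
      intro h; simp only [hT', if_pos h] at hα; exact hα rfl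
    have hmem := hAsupp α.1 hJA
    exact ⟨fun h => hv (h ▸ arrowHead_mem hmem), fun h => hv (h ▸ arrowTail_mem hmem)⟩
  have hmval_split : ∀ v, Rivasseau.mval arrowHead arrowTail T v =
      Rivasseau.mval arrowHead arrowTail T' v + Rivasseau.mval arrowHead arrowTail T'' v := fun v => by
    rw [← mval_add, ← hsplit]
  -- hypotheses of Rivasseau's lemma for `T'` with distinguished vertex `a`
  have h1 : 0 < Rivasseau.mval arrowHead arrowTail T' a := by
    have := hmval_split a
    rw [hmvalT a, if_pos rfl, if_neg hac, hT''avoid a haC] at this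
    linarith
  have hloop : ∀ α, T' α ≠ 0 → arrowHead α ≠ arrowTail α := by
    intro α hα
    have hJA : JA α.1 ≠ 0 := by intro h; simp only [hT', if_pos h] at hα; exact hα rfl
    refine arrowHead_ne_arrowTail fun h => hJA ?_
    have : α.1 = (α.1.1, α.1.1) := Prod.ext rfl h.symm
    rw [this]; exact hdiag _
  -- negative-valence vertices of `T'` lie in `A ∩ C`
  have hneg : ∀ w, Rivasseau.mval arrowHead arrowTail T' w < 0 → w ∈ A ∩ C := by
    intro w hw
    rw [Finset.mem_inter]
    constructor
    · by_contra h; rw [hT'avoid w h] at hw; exact lt_irrefl _ hw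
    · by_contra h
      have := hmval_split w
      rw [hT''avoid w h, add_zero, hmvalT w] at this
      have hwc : w ≠ c := fun e => h (e ▸ hc)
      rw [if_neg hwc] at this
      split_ifs at this <;> linarith
  have key := Rivasseau.sum_choose_mval_zero_le' arrowHead arrowTail T' hloop a h1
  -- rewrite both sides of the goal as sums over `subMult T'`
  have hsub : Rivasseau.subMult T' ⊆ Rivasseau.subMult T := by
    intro j hj
    rw [Rivasseau.subMult, Fintype.mem_piFinset] at hj ⊢
    intro α
    have := Finset.mem_range.1 (hj α)
    refine Finset.mem_range.2 (lt_of_lt_of_le this (Nat.succ_le_succ ?_))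
    simp only [hT']; split_ifs <;> simp
  have hmemT' : ∀ j, j ∈ Rivasseau.subMult T' ↔ (j ∈ Rivasseau.subMult T ∧ ∀ α, JA α.1 = 0 → j α = 0) := by
    intro j
    constructor
    · intro hj
      refine ⟨hsub hj, fun α hα => ?_⟩
      rw [Rivasseau.subMult, Fintype.mem_piFinset] at hj
      have := Finset.mem_range.1 (hj α)
      simp only [hT', if_pos hα] at this
      omega
    · rintro ⟨hj, hsupp⟩
      rw [Rivasseau.subMult, Fintype.mem_piFinset] at hj ⊢
      intro α
      by_cases hα : JA α.1 = 0
      · rw [hsupp α hα]; simp [hT', hα]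
      · have := hj α; simp only [hT', if_neg hα]; exact this
  have hchoose : ∀ j : (V × V) × Bool → ℕ, (∀ α, JA α.1 = 0 → j α = 0) →
      (∏ α, ((T α).choose (j α) : ℝ)) = ((∏ α, (T' α).choose (j α) : ℕ) : ℝ) := by
    intro j hsupp
    push_cast
    refine Finset.prod_congr rfl fun α _ => ?_
    by_cases hα : JA α.1 = 0
    · rw [hsupp α hα]; simp [hT', hα]
    · simp [hT', hα]
  -- generic conversion of a constrained sum over `subMult T` into one over `subMult T'`
  have hconv : ∀ (P : ((V × V) × Bool → ℕ) → Prop) [DecidablePred P],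
      (∑ j ∈ Rivasseau.subMult T, (if (∀ α, JA α.1 = 0 → j α = 0) ∧ P j then ∏ α, ((T α).choose (j α) : ℝ) else 0)) =
        ((∑ j ∈ (Rivasseau.subMult T').filter P, ∏ α, (T' α).choose (j α) : ℕ) : ℝ) := by
    intro P _
    push_cast
    rw [Finset.sum_filter, ← Finset.sum_subset hsub]
    · refine Finset.sum_congr rfl fun j hj => ?_
      have hsupp := ((hmemT' j).1 hj).2
      by_cases hP : P j
      · rw [if_pos ⟨hsupp, hP⟩, if_pos hP, hchoose j hsupp]; push_cast; rfl
      · rw [if_neg (fun h => hP h.2), if_neg hP]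
    · intro j hj hj'
      rw [if_neg]
      rintro ⟨hsupp, -⟩
      exact hj' ((hmemT' j).2 ⟨hj, hsupp⟩)
  rw [hconv, Finset.sum_congr rfl fun b _ => hconv (fun j => Balances (kvec a b) j)]
  -- left side ≤ Rivasseau's `K`-sum ≤ the `b`-indexed double sum
  have hL : ((∑ j ∈ (Rivasseau.subMult T').filter (fun j => Balances 0 j), ∏ α, (T' α).choose (j α) : ℕ) : ℝ) ≤
      ((∑ j ∈ (Rivasseau.subMult T').filter (fun n => Rivasseau.mval arrowHead arrowTail n a = 1 ∧
          ∃ w, Rivasseau.mval arrowHead arrowTail T' w < 0 ∧ Rivasseau.mval arrowHead arrowTail n w = -1 ∧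
            ∀ u, u ≠ a → u ≠ w → Rivasseau.mval arrowHead arrowTail n u = 0), ∏ α, (T' α).choose (j α) : ℕ) : ℝ) := by
    have hfilt : (Rivasseau.subMult T').filter (fun j => Balances 0 j) =
        (Rivasseau.subMult T').filter (fun n => ∀ v, Rivasseau.mval arrowHead arrowTail n v = 0) :=
      Finset.filter_congr fun j _ => balances_zero_iff j
    rw [hfilt]
    exact_mod_cast key
  refine hL.trans ?_
  -- embed the `K`-sum into the double sum: each `j ∈ K` is counted in the summand of its endpoint `w ∈ A ∩ C`
  have hK : (∑ j ∈ (Rivasseau.subMult T').filter (fun n => Rivasseau.mval arrowHead arrowTail n a = 1 ∧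
          ∃ w, Rivasseau.mval arrowHead arrowTail T' w < 0 ∧ Rivasseau.mval arrowHead arrowTail n w = -1 ∧
            ∀ u, u ≠ a → u ≠ w → Rivasseau.mval arrowHead arrowTail n u = 0), ∏ α, (T' α).choose (j α)) ≤
      ∑ b ∈ A ∩ C, ∑ j ∈ (Rivasseau.subMult T').filter (fun j => Balances (kvec a b) j), ∏ α, (T' α).choose (j α) := by
    rw [Finset.sum_filter, Finset.sum_congr rfl fun b _ => Finset.sum_filter _ _, Finset.sum_comm]
    refine Finset.sum_le_sum fun j _ => ?_
    split_ifs with hKj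
    · obtain ⟨hja, w, hw, hjw, hju⟩ := hKj
      have haw : a ≠ w := by
        intro h; rw [← h] at hjw; omega
      have hwAC := hneg w hw
      have hPw : Balances (kvec a w) j := (balances_kvec_iff haw j).2 ⟨hja, hjw, hju⟩
      calc ∏ α, (T' α).choose (j α)
          = (if Balances (kvec a w) j then ∏ α, (T' α).choose (j α) else 0) := by rw [if_pos hPw]
        _ ≤ ∑ b ∈ A ∩ C, (if Balances (kvec a b) j then ∏ α, (T' α).choose (j α) else 0) :=
            Finset.single_le_sum (f := fun b => if Balances (kvec a b) j then ∏ α, (T' α).choose (j α) else 0)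
              (fun b _ => Nat.zero_le _) hwAC
    · exact Nat.zero_le _
  rw [← Nat.cast_sum]
  exact_mod_cast hK

/-! ### P6. Assembly: the unnormalised inequality -/

omit [Fintype V] in
/-- `kvec b c + kvec a b = kvec a c`. [folklore] -/
private theorem kvec_add_kvec (a b c : V) : kvec b c + kvec a b = kvec a c := by
  funext v; simp only [kvec, Pi.add_apply, Pi.sub_apply]; ring

/-- The constrained Poisson weight `[T balances k] · W_K(T)`. [cite: Lieb1980, p. 133 (power series in β)] -/
private def bw (K : V × V → ℝ) (k : V → ℤ) (T : (V × V) × Bool → ℕ) : ℝ :=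
  if Balances k T then poissonWeight K T else 0

/-- `bw ≥ 0` for non-negative couplings. [folklore] -/
private theorem bw_nonneg {K : V × V → ℝ} (hK : ∀ p, 0 ≤ K p) (k : V → ℤ) (T : (V × V) × Bool → ℕ) : 0 ≤ bw K k T := by
  unfold bw; split_ifs; exacts [poissonWeight_nonneg hK T, le_rfl]

/-- `bw K k` is summable for non-negative couplings. [folklore] -/
private theorem summable_bw {K : V × V → ℝ} (hK : ∀ p, 0 ≤ K p) (k : V → ℤ) : Summable (bw K k) :=
  summable_poissonWeight hK _

/-- `‖bw K k ·‖` is summable for non-negative couplings. [folklore] -/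
private theorem summable_norm_bw {K : V × V → ℝ} (hK : ∀ p, 0 ≤ K p) (k : V → ℤ) : Summable fun T => ‖bw K k T‖ :=
  (summable_bw hK k).congr fun T => (Real.norm_of_nonneg (bw_nonneg hK k T)).symm

/-- The inner constrained binomial sum `∑_{j ≤ T} [supp j ⊆ S_A ∧ j balances k'] ∏C(T,j)`. [cite: Rivasseau1980, Lemma (p. 146)] -/
private def innerSum (JA : V × V → ℝ) (k' : V → ℤ) (T : (V × V) × Bool → ℕ) : ℝ :=
  ∑ j ∈ Rivasseau.subMult T, (if (∀ α, JA α.1 = 0 → j α = 0) ∧ Balances k' j then ∏ α, ((T α).choose (j α) : ℝ) else 0)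

variable [MeasurableSpace Circle] [BorelSpace Circle]

omit [MeasurableSpace Circle] [BorelSpace Circle] in
/-- **The termwise identity of the regrouping (P3/P4).** For `j ≤ T`, disjoint slot supports and exponents `k`, `k'`:
`bw_J^{k}(T − j) · bw_A^{k'}(j) = bw_J^{k+k'}(T) · ([supp j ⊆ S_A ∧ j balances k'] · ∏C(T,j))`. [cite: Lieb1980, p. 133 (subgraphs of the directed graph)] -/
private theorem term_identity {JA JC : V × V → ℝ} (hdisj : ∀ p, JA p ≠ 0 → JC p = 0) (k k' : V → ℤ)
    {T j : (V × V) × Bool → ℕ} (hj : j ∈ Rivasseau.subMult T) :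
    bw (JA + JC) k (T - j) * bw JA k' j =
      bw (JA + JC) (k + k') T *
        (if (∀ α, JA α.1 = 0 → j α = 0) ∧ Balances k' j then ∏ α, ((T α).choose (j α) : ℝ) else 0) := by
  have hjT : ∀ a, j a ≤ T a := fun a => by
    rw [Rivasseau.subMult, Fintype.mem_piFinset] at hj
    exact Nat.lt_succ_iff.1 (Finset.mem_range.1 (hj a))
  unfold bw
  by_cases hsupp : ∀ α, JA α.1 = 0 → j α = 0
  · -- `W_A(j) = W_J(j)` and the binomial identity
    have hWA : poissonWeight JA j = poissonWeight (JA + JC) j := by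
      refine poissonWeight_congr fun α hα => ?_
      have hJA : JA α.1 ≠ 0 := fun h => hα (hsupp α h)
      rw [Pi.add_apply, hdisj α.1 hJA, add_zero]
    have hbin := poissonWeight_mul_poissonWeight_sub (JA + JC) (T := T) (n := j) hjT
    by_cases h2 : Balances k' j
    · by_cases h1 : Balances k (T - j)
      · have h12 : Balances (k + k') T := ((balances_sub_iff hjT k k').1 ⟨h1, h2⟩).1
        rw [if_pos h1, if_pos h2, if_pos h12, if_pos ⟨hsupp, h2⟩, hWA, mul_comm, hbin]
      · have h12 : ¬Balances (k + k') T := fun h => h1 ((balances_sub_iff hjT k k').2 ⟨h, h2⟩).1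
        rw [if_neg h1, zero_mul, if_neg h12, zero_mul]
    · have hc : ¬((∀ α, JA α.1 = 0 → j α = 0) ∧ Balances k' j) := fun h => h2 h.2
      rw [if_neg h2, mul_zero, if_neg hc, mul_zero]
  · -- `j` charges a slot outside `S_A`: `W_A(j) = 0`
    have hc : ¬((∀ α, JA α.1 = 0 → j α = 0) ∧ Balances k' j) := fun h => hsupp h.1
    push Not at hsupp
    obtain ⟨α, hα, hjα⟩ := hsupp
    have hW : poissonWeight JA j = 0 := poissonWeight_eq_zero_of_charge hα hjα
    rw [hW, ite_self, mul_zero, if_neg hc, mul_zero]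

omit [MeasurableSpace Circle] [BorelSpace Circle] in
/-- The regrouped inner sum in closed form. [cite: Lieb1980, p. 133 (subgraphs of the directed graph)] -/
private theorem inner_regrouped {JA JC : V × V → ℝ} (hdisj : ∀ p, JA p ≠ 0 → JC p = 0) (k k' : V → ℤ)
    (T : (V × V) × Bool → ℕ) :
    ∑ j ∈ Rivasseau.subMult T, bw (JA + JC) k (T - j) * bw JA k' j = bw (JA + JC) (k + k') T * innerSum JA k' T := by
  rw [innerSum, Finset.mul_sum]
  exact Finset.sum_congr rfl fun j hj => term_identity hdisj k k' hj

/-- **B6 core (P6).** Disjoint slot supports, `a ∈ A ∖ C`, `c ∈ C`, no diagonal `A`-couplings: the UNNORMALISED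
Lieb–Rivasseau inequality `N_J(a,c) · Z_{J_A} ≤ ∑_{b ∈ A∩C} N_{J_A}(a,b) · N_J(b,c)`. [cite: Lieb1980, eq. (23)] -/
theorem liebRivasseau_unnormalised (A C : Finset V) (JA JC : V × V → ℝ) (hA0 : ∀ p, 0 ≤ JA p)
    (hC0 : ∀ p, 0 ≤ JC p) (hAsupp : ∀ p, JA p ≠ 0 → p.1 ∈ A ∧ p.2 ∈ A) (hCsupp : ∀ p, JC p ≠ 0 → p.1 ∈ C ∧ p.2 ∈ C)
    (hdisj : ∀ p, JA p ≠ 0 → JC p = 0) (hdiag : ∀ x, JA (x, x) = 0) {a c : V} (haC : a ∉ C)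
    (hc : c ∈ C) :
    (∫ θ, cosDiff a c θ * ginibreWeight (pairChars V) (JA + JC) θ ∂torusHaar V) *
        (∫ θ, ginibreWeight (pairChars V) JA θ ∂torusHaar V) ≤
      ∑ b ∈ A ∩ C, (∫ θ, cosDiff a b θ * ginibreWeight (pairChars V) JA θ ∂torusHaar V) *
        (∫ θ, cosDiff b c θ * ginibreWeight (pairChars V) (JA + JC) θ ∂torusHaar V) := by
  classical
  haveI : Nonempty V := ⟨a⟩
  have hJ0 : ∀ p, 0 ≤ (JA + JC) p := fun p => add_nonneg (hA0 p) (hC0 p)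
  -- the four factors as series over ℕ-currents
  have hNJ : ∀ x y, ∫ θ, cosDiff x y θ * ginibreWeight (pairChars V) (JA + JC) θ ∂torusHaar V =
      ∑' T, bw (JA + JC) (kvec x y) T := fun x y => by
    rw [integral_cosDiff_mul_ginibreWeight_eq_tsum]; rfl
  have hNA : ∀ x y, ∫ θ, cosDiff x y θ * ginibreWeight (pairChars V) JA θ ∂torusHaar V = ∑' T, bw JA (kvec x y) T :=
    fun x y => by rw [integral_cosDiff_mul_ginibreWeight_eq_tsum]; rfl
  have hZA : ∫ θ, ginibreWeight (pairChars V) JA θ ∂torusHaar V = ∑' T, bw JA 0 T := by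
    rw [integral_ginibreWeight_eq_tsum_poissonWeight]; rfl
  -- products of series, regrouped by the total current
  have hpair : ∀ k k', Summable fun p : ((V × V) × Bool → ℕ) × ((V × V) × Bool → ℕ) =>
      bw (JA + JC) k p.1 * bw JA k' p.2 :=
    fun k k' => summable_mul_of_summable_norm (summable_norm_bw hJ0 k) (summable_norm_bw hA0 k')
  have hprod : ∀ k k', (∑' T, bw (JA + JC) k T) * (∑' T, bw JA k' T) =
      ∑' T, bw (JA + JC) (k + k') T * innerSum JA k' T := by
    intro k k'
    rw [tsum_mul_tsum_of_summable_norm (summable_norm_bw hJ0 k) (summable_norm_bw hA0 k'),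
      tsum_pair_eq_tsum_sum_subMult (F := fun n₁ n₂ => bw (JA + JC) k n₁ * bw JA k' n₂) (hpair k k')]
    exact tsum_congr fun T => inner_regrouped hdisj k k' T
  have hsumm : ∀ k k', Summable fun T => bw (JA + JC) (k + k') T * innerSum JA k' T := by
    intro k k'
    exact (summable_sum_subMult (F := fun n₁ n₂ => bw (JA + JC) k n₁ * bw JA k' n₂) (hpair k k')).congr
      fun T => inner_regrouped hdisj k k' T
  -- rewrite both sides
  have hL : (∫ θ, cosDiff a c θ * ginibreWeight (pairChars V) (JA + JC) θ ∂torusHaar V) *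
      (∫ θ, ginibreWeight (pairChars V) JA θ ∂torusHaar V) = ∑' T, bw (JA + JC) (kvec a c) T * innerSum JA 0 T := by
    rw [hNJ, hZA, hprod, add_zero]
  have hR : ∀ b, (∫ θ, cosDiff a b θ * ginibreWeight (pairChars V) JA θ ∂torusHaar V) *
      (∫ θ, cosDiff b c θ * ginibreWeight (pairChars V) (JA + JC) θ ∂torusHaar V) =
        ∑' T, bw (JA + JC) (kvec a c) T * innerSum JA (kvec a b) T := by
    intro b
    rw [hNA, hNJ, mul_comm, hprod, kvec_add_kvec]
  rw [hL, Finset.sum_congr rfl fun b _ => hR b]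
  have hsummL : Summable fun T => bw (JA + JC) (kvec a c) T * innerSum JA 0 T := by
    have := hsumm (kvec a c) 0; rwa [add_zero] at this
  have hsummR : ∀ b, Summable fun T => bw (JA + JC) (kvec a c) T * innerSum JA (kvec a b) T := by
    intro b; have := hsumm (kvec b c) (kvec a b); rwa [kvec_add_kvec] at this
  rw [← Summable.tsum_finsetSum (fun b _ => hsummR b)]
  refine Summable.tsum_le_tsum (fun T => ?_) hsummL (summable_sum fun b _ => hsummR b)
  rw [← Finset.mul_sum]
  by_cases hW : bw (JA + JC) (kvec a c) T = 0
  · rw [hW, zero_mul, zero_mul]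
  · refine mul_le_mul_of_nonneg_left ?_ (bw_nonneg hJ0 _ T)
    have hac : a ≠ c := fun h => haC (h ▸ hc)
    have hBal : Balances (kvec a c) T := by
      by_contra h; exact hW (by rw [bw, if_neg h])
    have hT : ∀ α, T α ≠ 0 → JA α.1 ≠ 0 ∨ JC α.1 ≠ 0 := by
      intro α hα
      by_contra h
      push Not at h
      have hJα : (JA + JC) α.1 = 0 := by rw [Pi.add_apply, h.1, h.2, add_zero]
      exact hW (by rw [bw, if_pos hBal, poissonWeight_eq_zero_of_charge hJα hα])
    exact inner_sum_le A C JA JC hAsupp hCsupp hdiag haC hc hT hBal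

/-! ### Reductions and the normalised inequality -/

/-- The two-point function ignores diagonal couplings (`cos(θ_x − θ_x) = 1` is a constant in the weight).
[cite: Lieb1980, p. 132 (pairwise interactions −J_{ab} cos(θ_a − θ_b))] -/
theorem twoPoint_congr_offDiag {J J' : V × V → ℝ} (h : ∀ p : V × V, p.1 ≠ p.2 → J p = J' p) (x y : V) :
    twoPoint J x y = twoPoint J' x y := by
  classical
  -- the weights differ by the constant factor `exp(∑_diag (J − J'))`
  set d : ℝ := ∑ p : V × V, if p.1 = p.2 then (J p - J' p) else 0 with hd
  have hw : ∀ θ : V → Circle, ginibreWeight (pairChars V) J θ = Real.exp d * ginibreWeight (pairChars V) J' θ := by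
    intro θ
    rw [ginibreWeight, ginibreWeight, ← Real.exp_add, ginibreHamiltonian, ginibreHamiltonian, hd, ← Finset.sum_add_distrib]
    congr 1
    refine Finset.sum_congr rfl fun p _ => ?_
    by_cases hp : p.1 = p.2
    · have hre : reChar (pairChars V p) θ = 1 := by
        rw [pairChars_apply, reChar, diffChar_apply, hp, inv_mul_cancel, Circle.coe_one, Complex.one_re]
      rw [if_pos hp, hre]; ring
    · rw [if_neg hp, h p hp]; ring
  unfold twoPoint ginibreExpect
  simp_rw [hw]
  have hpos : (0 : ℝ) < Real.exp d := Real.exp_pos d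
  rw [show (fun θ : V → Circle => cosDiff x y θ * (Real.exp d * ginibreWeight (pairChars V) J' θ)) =
      fun θ => Real.exp d * (cosDiff x y θ * ginibreWeight (pairChars V) J' θ) from funext fun θ => by ring,
    integral_const_mul, integral_const_mul, mul_div_mul_left _ _ hpos.ne']

omit [DecidableEq V] in
/-- `⟨cos(θ_a − θ_a)⟩ = 1`. [folklore] -/
private theorem twoPoint_self (J : V × V → ℝ) (a : V) : twoPoint J a a = 1 := by
  unfold twoPoint ginibreExpect
  have h1 : ∀ θ : V → Circle, cosDiff a a θ = 1 := fun θ => by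
    rw [cosDiff, ← Complex.normSq_eq_conj_mul_self, Complex.ofReal_re, Circle.normSq_coe]
  simp_rw [h1, one_mul]
  exact div_self (integral_exp_pos (integrable_torusHaar_of_continuous (continuous_ginibreWeight _ _))).ne'

omit [DecidableEq V] in
/-- The unnormalised integral `N_K(x,y)` in terms of `twoPoint`: `N = twoPoint · Z`. [folklore] -/
private theorem integral_cosDiff_mul_eq_twoPoint_mul (K : V × V → ℝ) (x y : V) :
    ∫ θ, cosDiff x y θ * ginibreWeight (pairChars V) K θ ∂torusHaar V =
      twoPoint K x y * ∫ θ, ginibreWeight (pairChars V) K θ ∂torusHaar V := by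
  unfold twoPoint ginibreExpect
  rw [div_mul_cancel₀]
  exact (integral_exp_pos (integrable_torusHaar_of_continuous (continuous_ginibreWeight _ _))).ne'

omit [MeasurableSpace Circle] [BorelSpace Circle] in
/-- **B6.** The Lieb–Rivasseau separating inequality for plane rotators HOLDS: the tree's named fact
`PlaneRotator.LiebRivasseauInequality` (Lieb 1980 eq. (23) / Rivasseau 1980) is a theorem. Proof: reductions
(the case `a ∈ C` is the term `b = a`; the `B × B` part of `J_A` is moved into `J_C` — Ginibre monotonicity restores
the stated right-hand side — and diagonal couplings are dropped), then `liebRivasseau_unnormalised` divided by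
`Z_J Z_{J_A}`. [cite: Lieb1980, eq. (23) and notes added in proof (2)] -/
theorem liebRivasseauInequality_holds : LiebRivasseauInequality := by
  intro V _ _ _ _ A C JA JC hA0 hC0 hAsupp hCsupp a ha c hc
  classical
  have hJ0 : ∀ p, 0 ≤ (JA + JC) p := fun p => add_nonneg (hA0 p) (hC0 p)
  by_cases haC : a ∈ C
  · -- the term `b = a` alone dominates
    have hmem : a ∈ A ∩ C := Finset.mem_inter.2 ⟨ha, haC⟩
    calc twoPoint (JA + JC) a c = twoPoint JA a a * twoPoint (JA + JC) a c := by rw [twoPoint_self, one_mul]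
      _ ≤ ∑ b ∈ A ∩ C, twoPoint JA a b * twoPoint (JA + JC) b c :=
          Finset.single_le_sum (f := fun b => twoPoint JA a b * twoPoint (JA + JC) b c)
            (fun b _ => mul_nonneg (twoPoint_nonneg hA0 _ _) (twoPoint_nonneg hJ0 _ _)) hmem
  -- reductions: move the `C × C` part of `J_A` into `J_C`, drop the diagonal
  set JA' : V × V → ℝ := fun p => if (p.1 ∈ C ∧ p.2 ∈ C) ∨ p.1 = p.2 then 0 else JA p with hJA'
  set JC' : V × V → ℝ := fun p => if p.1 = p.2 then 0 else JC p + (if p.1 ∈ C ∧ p.2 ∈ C then JA p else 0) with hJC'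
  have hA'0 : ∀ p, 0 ≤ JA' p := fun p => by simp only [hJA']; split_ifs; exacts [le_rfl, hA0 p]
  have hC'0 : ∀ p, 0 ≤ JC' p := fun p => by
    simp only [hJC']; split_ifs; exacts [le_rfl, add_nonneg (hC0 p) (hA0 p), by simpa using hC0 p]
  have hA'le : ∀ p, JA' p ≤ JA p := fun p => by simp only [hJA']; split_ifs; exacts [hA0 p, le_rfl]
  have hA'supp : ∀ p, JA' p ≠ 0 → p.1 ∈ A ∧ p.2 ∈ A := fun p hp => by
    refine hAsupp p fun h => hp ?_
    simp only [hJA', h]; split_ifs <;> rfl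
  have hC'supp : ∀ p, JC' p ≠ 0 → p.1 ∈ C ∧ p.2 ∈ C := fun p hp => by
    simp only [hJC'] at hp
    split_ifs at hp with h1 h2
    · exact absurd rfl hp
    · exact h2
    · rw [add_zero] at hp; exact hCsupp p hp
  have hdisj : ∀ p, JA' p ≠ 0 → JC' p = 0 := fun p hp => by
    simp only [hJA'] at hp
    split_ifs at hp with h
    · exact absurd rfl hp
    · push Not at h
      have hnC : ¬(p.1 ∈ C ∧ p.2 ∈ C) := fun hh => h.1 hh.1 hh.2
      simp only [hJC', if_neg h.2, if_neg hnC, add_zero]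
      by_contra hJC
      exact hnC (hCsupp p hJC)
  have hdiag : ∀ x, JA' (x, x) = 0 := fun x => by simp [hJA']
  have hoff : ∀ p : V × V, p.1 ≠ p.2 → (JA + JC) p = (JA' + JC') p := fun p hp => by
    simp only [Pi.add_apply, hJA', hJC', if_neg hp]
    by_cases h : p.1 ∈ C ∧ p.2 ∈ C
    · rw [if_pos (Or.inl h), if_pos h]; ring
    · rw [if_neg (fun hh => hh.elim h hp), if_neg h]; ring
  -- the core inequality for the reduced couplings
  have core := liebRivasseau_unnormalised A C JA' JC' hA'0 hC'0 hA'supp hC'supp hdisj hdiag haC hc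
  have hJ'0 : ∀ p, 0 ≤ (JA' + JC') p := fun p => add_nonneg (hA'0 p) (hC'0 p)
  set ZJ := ∫ θ, ginibreWeight (pairChars V) (JA' + JC') θ ∂torusHaar V with hZJ
  set ZA := ∫ θ, ginibreWeight (pairChars V) JA' θ ∂torusHaar V with hZA
  have hZJpos : 0 < ZJ := integral_exp_pos (integrable_torusHaar_of_continuous (continuous_ginibreWeight _ _))
  have hZApos : 0 < ZA := integral_exp_pos (integrable_torusHaar_of_continuous (continuous_ginibreWeight _ _))
  rw [integral_cosDiff_mul_eq_twoPoint_mul, Finset.sum_congr rfl fun b _ => by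
    rw [integral_cosDiff_mul_eq_twoPoint_mul, integral_cosDiff_mul_eq_twoPoint_mul]] at core
  -- divide by `Z_J Z_A`
  have core' : twoPoint (JA' + JC') a c ≤ ∑ b ∈ A ∩ C, twoPoint JA' a b * twoPoint (JA' + JC') b c := by
    have h := div_le_div_of_nonneg_right core (mul_pos hZJpos hZApos).le
    rw [mul_div_mul_right _ _ hZApos.ne', mul_div_cancel_right₀ _ hZJpos.ne', Finset.sum_div] at h
    refine h.trans (le_of_eq (Finset.sum_congr rfl fun b _ => ?_))
    rw [← hZJ, ← hZA]
    field_simp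
  -- back to the original couplings
  calc twoPoint (JA + JC) a c = twoPoint (JA' + JC') a c := twoPoint_congr_offDiag hoff a c
    _ ≤ ∑ b ∈ A ∩ C, twoPoint JA' a b * twoPoint (JA' + JC') b c := core'
    _ ≤ ∑ b ∈ A ∩ C, twoPoint JA a b * twoPoint (JA + JC) b c := by
        refine Finset.sum_le_sum fun b _ => ?_
        rw [← twoPoint_congr_offDiag hoff b c]
        exact mul_le_mul_of_nonneg_right (twoPoint_mono hA'0 hA'le a b) (twoPoint_nonneg hJ0 _ _)

end PlaneRotator

end Literature.Probability.LatticeModels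

end
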